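import Literature.Topology.FourManifolds.AffineAmbientIsotopy
import Literature.Topology.FourManifolds.StraightLineAmbientIsotopy
import Literature.Topology.FourManifolds.Homogeneity
import HarnessLib

/-!
# The disc argument of the Schoenflies isotopy theorem, in a chart of `ℝ³`

Topic `Literature/Topology/FourManifolds` (trunk T-4MAN). First of two files proving the
*isotopy form* of the Schoenflies theorem in `S³`
(`Literature.Topology.FourManifolds.SphereEmbedding.schoenflies_exists_ambientIsotopy_image_eq_sphereEquator`,
`SchoenfliesSphereThree.lean`: every smoothly embedded 2-sphere in `𝕊 3` is carried onto the
equator by an ambient isotopy) from its *ball form*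
(`Literature.Topology.FourManifolds.SphereEmbedding.schoenflies_exists_ball`, Alexander's theorem: the sphere bounds a
smoothly embedded ball), as a step of the decomposition of the named fact
`Literature.Topology.FourManifolds.Knot.IsConnectedSum.isIsotopic` (`BandSum.lean`, Schubert 1949: the connected sum of
oriented knots is well defined), whose reduction `Knot.IsConnectedSum.isIsotopic_of_normalPosition`
(`ConnectedSumNormalForm.lean`) consumes the isotopy form. The passage ball form ⇒ isotopy form
is the disc theorem of Palais–Cerf in Hirsch's isotopy formulation (Hirsch (1976), Ch. 8 §3,
Thm. 3.1 with §1, Thm. 1.3), for the *image* of the disc (so that no orientation hypothesis is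
needed). This file carries out the Euclidean part of that argument, entirely inside one chart
of `ℝ³`; everything is proved, no named facts are introduced:

* `Literature.Topology.FourManifolds.exists_ambientIsotopy_image_sphere_of_chart` — for a smooth chart `Φ` of `ℝ³` with
  full target whose inverse `f = Φ⁻¹` fixes `0` and has derivative `L` at `0` with `det L > 0`,
  and any `a > 0`, `q`, there is an ambient isotopy of `ℝ³`, stationary off one ball, whose end
  stage carries `f (S(0, a))` onto the round sphere `S(q, 2)`: contract `S(0, a)` to a small
  `S(0, η)` in the source and transport along `Φ` (`AmbientIsotopy.alongChart`,
  `Homogeneity.lean`); the straight-line isotopy from `id` to `f ∘ L⁻¹` is ambient near `0`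
  (`exists_ambientIsotopy_of_straightLine_one`, `StraightLineAmbientIsotopy.lean`, Hirsch's
  Thm. 8.1.4); and `z ↦ q + 2 z`, `η L` are joined in the affine group with `det > 0`
  (`AffineIsotopy.exists_ambientIsotopy_affine`, `AffineAmbientIsotopy.lean`);
* `Literature.Topology.FourManifolds.exists_ambientIsotopy_image_sphere_of_chart'` — the same without the sign
  hypothesis on `det L` (precompose `f` with a coordinate reflection,
  `exists_reflection_three`, which preserves `S(0, a)`);
* bookkeeping lemmas: support of `AmbientIsotopy.comp` / `AmbientIsotopy.reverse`, images of
  round spheres under homotheties and translations, scalar multiples of automorphisms of `ℝ³`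
  and their determinants (`AffineIsotopy.det_toMat_smul`).

The sphere-level assembly is `SchoenfliesIsotopy.lean`.

## References

* M. W. Hirsch, *Differential Topology*, GTM 33, Springer (1976), Ch. 8 §1, Thms. 1.3–1.4
  (isotopy extension, PDF p. 167 of the held copy `book:hirsch1976-differential-topology`);
  Ch. 8 §3, Thm. 3.1 and its proof (PDF p. 172: discs are isotopic through their linear parts,
  "since `GL⁺(n)` is connected"). [HirschDT1976]
* R. Palais, *Extending diffeomorphisms*, Proc. AMS 11 (1960), 274–277. [Palais1960]

## Design notes

* Charts are Mathlib `OpenPartialHomeomorph (𝔼 3) (𝔼 3)` with `target = univ`, as in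
  `ChartTransport.lean` / `Homogeneity.lean`; "stationary off one ball" is
  `∀ t y, R ≤ ‖y‖ → H.toFun t y = y`, the support format of `AmbientIsotopy.alongChart`.
* Dimension `3` only: the `GL⁺`-path is the tree's `AffineAmbientIsotopy.lean` (`SL(3, ℝ)`
  paths of `SpecialLinearPath.lean`).
* The file declares theorems only (no new definitions).
-/

open scoped Manifold ContDiff Topology Matrix
open Function Set Metric

noncomputable section

namespace Literature.Topology.FourManifolds

/-- Local notation: `𝔼 n` is the model Euclidean space `EuclideanSpace ℝ (Fin n)`. -/
local notation "𝔼 " n:arg => EuclideanSpace ℝ (Fin n)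

/-! ### Support of composed and reversed ambient isotopies -/

namespace AmbientIsotopy

variable {E : Type*} [NormedAddCommGroup E] [NormedSpace ℝ E]

/-- If all stages of `F` and `G` are the identity off the ball `B(0, R)`, so are the stages of
the stagewise composition `F.comp G`. [folklore] -/
theorem comp_eq_self_of_le {F G : AmbientIsotopy 𝓘(ℝ, E) E} {R : ℝ}
    (hF : ∀ t y, R ≤ ‖y‖ → F.toFun t y = y) (hG : ∀ t y, R ≤ ‖y‖ → G.toFun t y = y)
    (t : ℝ) (y : E) (hy : R ≤ ‖y‖) : (F.comp G).toFun t y = y := by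
  rw [comp_toFun, comp_apply, hF t y hy, hG t y hy]

/-- If all stages of `F` are the identity off the ball `B(0, R)`, so are the stages of the
reversed isotopy `F.reverse`. [folklore] -/
theorem reverse_eq_self_of_le {F : AmbientIsotopy 𝓘(ℝ, E) E} {R : ℝ}
    (hF : ∀ t y, R ≤ ‖y‖ → F.toFun t y = y) (t : ℝ) (y : E) (hy : R ≤ ‖y‖) :
    F.reverse.toFun t y = y := by
  have h1 : (F.toDiffeomorph 1).symm y = y := by
    have h2 : (F.toDiffeomorph 1) ((F.toDiffeomorph 1).symm y) = (F.toDiffeomorph 1) y := by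
      rw [Diffeomorph.apply_symm_apply, coe_toDiffeomorph, hF 1 y hy]
    exact (F.toDiffeomorph 1).injective h2
  rw [reverse_toFun, comp_apply, h1, hF _ y hy]

/-- The end stage of the reversed isotopy undoes the end stage: `F⁻¹₁ (F₁ '' X) = X`. [folklore] -/
theorem reverse_one_image_image {HN EN : Type*} [NormedAddCommGroup EN] [NormedSpace ℝ EN]
    [TopologicalSpace HN] {J : ModelWithCorners ℝ EN HN} {N : Type*} [TopologicalSpace N]
    [ChartedSpace HN N] (F : AmbientIsotopy J N) (X : Set N) :
    F.reverse.toFun 1 '' (F.toFun 1 '' X) = X := by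
  rw [reverse_toFun_one, image_image]
  convert image_id X using 2 with x
  exact (F.toDiffeomorph 1).symm_apply_apply x

end AmbientIsotopy

/-! ### Elementary images of spheres -/

section Spheres

variable {E : Type*} [NormedAddCommGroup E] [NormedSpace ℝ E]

/-- A positive homothety maps the sphere of radius `r` about `0` onto the sphere of radius
`s r`. [folklore] -/
theorem image_smul_sphere_zero {s : ℝ} (hs : 0 < s) (r : ℝ) :
    (fun z : E ↦ s • z) '' sphere (0 : E) r = sphere 0 (s * r) := by
  ext w
  simp only [mem_image, mem_sphere_zero_iff_norm]
  constructor
  · rintro ⟨z, hz, rfl⟩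
    rw [norm_smul, Real.norm_of_nonneg hs.le, hz]
  · intro hw
    refine ⟨s⁻¹ • w, ?_, by rw [smul_smul, mul_inv_cancel₀ hs.ne', one_smul]⟩
    rw [norm_smul, norm_inv, Real.norm_of_nonneg hs.le, hw, inv_mul_cancel_left₀ hs.ne']

/-- The sphere of radius `2` about `q` is the image of the unit sphere under `z ↦ q + 2 z`.
[folklore] -/
theorem image_add_two_smul_sphere (q : E) :
    (fun z : E ↦ q + (2 : ℝ) • z) '' sphere (0 : E) 1 = sphere q 2 := by
  ext w
  simp only [mem_image, mem_sphere, dist_eq_norm, sub_zero]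
  constructor
  · rintro ⟨z, hz, rfl⟩
    rw [add_sub_cancel_left, norm_smul, hz, Real.norm_two, mul_one]
  · intro hw
    refine ⟨(2 : ℝ)⁻¹ • (w - q), ?_, ?_⟩
    · rw [norm_smul, hw, norm_inv, Real.norm_two]; norm_num
    · rw [smul_smul]; norm_num

end Spheres

/-! ### Scalar multiples of automorphisms of `ℝ³` and their determinants -/

namespace AffineIsotopy

/-- A nonzero scalar multiple of an automorphism of `ℝ³` is an automorphism. [folklore] -/
theorem exists_equiv_coe_eq_smul {s : ℝ} (hs : s ≠ 0) (L : 𝔼 3 ≃L[ℝ] 𝔼 3) :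
    ∃ S : 𝔼 3 ≃L[ℝ] 𝔼 3, (S : 𝔼 3 →L[ℝ] 𝔼 3) = s • (L : 𝔼 3 →L[ℝ] 𝔼 3) := by
  refine ⟨ContinuousLinearEquiv.equivOfInverse (s • (L : 𝔼 3 →L[ℝ] 𝔼 3))
    (s⁻¹ • (L.symm : 𝔼 3 →L[ℝ] 𝔼 3)) (fun x ↦ ?_) (fun x ↦ ?_), rfl⟩
  · simp [smul_smul, hs]
  · simp [smul_smul, hs]

/-- `det (s A) = s³ det A` on `ℝ³`. [folklore] -/
theorem det_toMat_smul (s : ℝ) (A : 𝔼 3 →L[ℝ] 𝔼 3) :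
    (toMat (s • A)).det = s ^ 3 * (toMat A).det := by
  rw [show toMat (s • A) = s • toMat A from map_smul _ s A, Matrix.det_smul, Fintype.card_fin]

/-- The identity of `ℝ³` has determinant `1`. [folklore] -/
theorem det_toMat_refl :
    (toMat ((ContinuousLinearEquiv.refl ℝ (𝔼 3) : 𝔼 3 ≃L[ℝ] 𝔼 3) : 𝔼 3 →L[ℝ] 𝔼 3)).det = 1 := by
  rw [ContinuousLinearEquiv.coe_refl, toMat_id, Matrix.det_one]

end AffineIsotopy

/-! ### The disc argument in a chart: three compactly supported ambient isotopies of `ℝ³` -/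

section Chart

open AffineIsotopy

/-- **Hirsch's disc argument, isotopy form, in one chart of `ℝ³`.** Let `Φ` be a smooth chart
of `ℝ³` with full target whose inverse `f = Φ⁻¹ : ℝ³ → ℝ³` (a smooth embedding onto the open
set `Φ.source`) fixes `0` and has derivative `L` at `0` with `det L > 0`. Then for every radius
`a > 0` and every centre `q` there is an ambient isotopy `H` of `ℝ³`, all of whose stages are
the identity off one ball, whose end stage carries the embedded sphere `f (S(0, a))` onto the
round sphere `S(q, 2)`. *Proof* (Hirsch (1976), Ch. 8 §3, proof of Thm. 3.1, run with isotopies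
instead of diffeomorphisms): (1) contract `S(0, a)` to the small sphere `S(0, η)` inside the
source and transport this homothety isotopy along `Φ` (`AmbientIsotopy.alongChart`), so that
`f (S(0, a))` is carried to `f (S(0, η))`; (2) near `0` the straight-line isotopy from the
identity to `f ∘ L⁻¹` is ambient (`exists_ambientIsotopy_of_straightLine_one`, Hirsch's
Thm. 8.1.4), and for `η` small its end stage carries `L (S(0, η))` onto `f (S(0, η))`; (3) the
affine maps `z ↦ q + 2 z` and `η L` have determinants of the same sign, so an ambient isotopy
carries `S(q, 2)` onto `η L (S(0, 1)) = L (S(0, η))` (`AffineIsotopy.exists_ambientIsotopy_affine`,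
"`GL⁺(3)` is connected"). Composing (1) with the reverses of (2) and (3) gives `H`.
[cite: HirschDT1976, Ch. 8 §3, Thm. 3.1 (proof)] -/
theorem exists_ambientIsotopy_image_sphere_of_chart
    (Φ : OpenPartialHomeomorph (𝔼 3) (𝔼 3)) (hΦt : Φ.target = univ)
    (hΦ : ContMDiffOn 𝓘(ℝ, 𝔼 3) 𝓘(ℝ, 𝔼 3) ∞ Φ Φ.source)
    (hΦ' : ContMDiff 𝓘(ℝ, 𝔼 3) 𝓘(ℝ, 𝔼 3) ∞ Φ.symm)
    (h0 : Φ.symm 0 = 0) {L : 𝔼 3 ≃L[ℝ] 𝔼 3}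
    (hL : HasFDerivAt Φ.symm (L : 𝔼 3 →L[ℝ] 𝔼 3) 0)
    (hdet : 0 < (toMat (L : 𝔼 3 →L[ℝ] 𝔼 3)).det) {a : ℝ} (ha : 0 < a) (q : 𝔼 3) :
    ∃ H : AmbientIsotopy 𝓘(ℝ, 𝔼 3) (𝔼 3),
      H.toFun 1 '' (Φ.symm '' sphere 0 a) = sphere q 2 ∧
      ∃ R : ℝ, ∀ t y, R ≤ ‖y‖ → H.toFun t y = y := by
  have hf : ContDiff ℝ ∞ (Φ.symm : 𝔼 3 → 𝔼 3) := contMDiff_iff_contDiff.1 hΦ'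
  -- Step 1: the straight-line isotopy from `id` to `f ∘ L⁻¹` is ambient near `0`
  set P : 𝔼 3 → 𝔼 3 := fun y ↦ Φ.symm (L.symm y) with hP_def
  have hP : ContDiff ℝ ∞ P := hf.comp (L.symm : 𝔼 3 →L[ℝ] 𝔼 3).contDiff
  have hP0 : ∀ z ∈ ({0} : Set (𝔼 3)), P z = z := by
    intro z hz
    rw [mem_singleton_iff.1 hz]
    simp [hP_def, h0]
  have hPD : ∀ z ∈ ({0} : Set (𝔼 3)), HasFDerivAt P (ContinuousLinearMap.id ℝ (𝔼 3)) z := by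
    intro z hz
    rw [mem_singleton_iff.1 hz]
    have h1 : HasFDerivAt Φ.symm (L : 𝔼 3 →L[ℝ] 𝔼 3) (L.symm 0) := by
      rw [map_zero]; exact hL
    have h2 := h1.comp (0 : 𝔼 3) (L.symm : 𝔼 3 →L[ℝ] 𝔼 3).hasFDerivAt
    rwa [ContinuousLinearEquiv.coe_comp_coe_symm] at h2
  have hinj : ∀ z ∈ ({0} : Set (𝔼 3)), ∀ t ∈ Icc (0 : ℝ) 1,
      Injective (slDeriv t (ContinuousLinearMap.id ℝ (𝔼 3))) := by
    intro z _ t _ x y hxy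
    simpa [slDeriv_apply] using hxy
  obtain ⟨FL, hFL, RL, hRL⟩ := exists_ambientIsotopy_of_straightLine_one isCompact_singleton
    isOpen_univ (subset_univ _) hP.contDiffOn hP0 hPD hinj
  rw [nhdsSet_singleton, Metric.eventually_nhds_iff] at hFL
  obtain ⟨ρ, hρ, hFLρ⟩ := hFL
  -- Step 2: a radius `η` with `L (B̄(0, η)) ⊆ B(0, ρ)`
  have hLpos : 0 < ‖(L : 𝔼 3 →L[ℝ] 𝔼 3)‖ + 1 := by positivity
  obtain ⟨η, hη, hηρ⟩ : ∃ η : ℝ, 0 < η ∧ (‖(L : 𝔼 3 →L[ℝ] 𝔼 3)‖ + 1) * η < ρ :=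
    ⟨ρ / (2 * (‖(L : 𝔼 3 →L[ℝ] 𝔼 3)‖ + 1)), by positivity, by
      rw [mul_div_assoc', div_lt_iff₀ (by positivity)]; nlinarith⟩
  have hηL : ∀ z : 𝔼 3, ‖z‖ = η → ‖L z‖ < ρ := by
    intro z hz
    calc ‖L z‖ ≤ ‖(L : 𝔼 3 →L[ℝ] 𝔼 3)‖ * ‖z‖ := (L : 𝔼 3 →L[ℝ] 𝔼 3).le_opNorm z
      _ ≤ (‖(L : 𝔼 3 →L[ℝ] 𝔼 3)‖ + 1) * η := by rw [hz]; gcongr; linarith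
      _ < ρ := hηρ
  -- Step 3: the homothety `z ↦ (η / a) z`, transported along `Φ`
  obtain ⟨S, hS⟩ := exists_equiv_coe_eq_smul (s := η / a) (by positivity)
    (ContinuousLinearEquiv.refl ℝ (𝔼 3))
  have hSapp : ∀ z, S z = (η / a) • z := fun z ↦ by
    have := congrArg (fun A : 𝔼 3 →L[ℝ] 𝔼 3 ↦ A z) hS
    simpa using this
  have hdetS : 0 < (toMat ((ContinuousLinearEquiv.refl ℝ (𝔼 3) : 𝔼 3 ≃L[ℝ] 𝔼 3) :
      𝔼 3 →L[ℝ] 𝔼 3)).det * (toMat (S : 𝔼 3 →L[ℝ] 𝔼 3)).det := by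
    rw [hS, det_toMat_smul, det_toMat_refl]; positivity
  obtain ⟨G, hG1, RG, hRG⟩ := exists_ambientIsotopy_affine 0 0 0
    (ContinuousLinearEquiv.refl ℝ (𝔼 3)) S hdetS a
  have hG1' : ∀ z : 𝔼 3, ‖z‖ = a → G.toFun 1 z = (η / a) • z := fun z hz ↦ by
    have := hG1 z (mem_closedBall_zero_iff.2 hz.le)
    simpa [hSapp] using this
  let Ψ : AmbientIsotopy 𝓘(ℝ, 𝔼 3) (𝔼 3) := G.alongChart (φ := Φ) hΦ hΦ' hΦt hRG
  have hΨ : ∀ t y, Ψ.toFun t (Φ.symm y) = Φ.symm (G.toFun t y) := fun t y ↦ by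
    change chartTransport Φ (G.toFun t) (Φ.symm y) = _
    exact chartTransport_symm_apply hΦt _ y
  obtain ⟨R₁, hR₁⟩ :=
    ((isCompact_closedBall (0 : 𝔼 3) RG).image hΦ'.continuous).isBounded.subset_closedBall 0
  have hΨsupp : ∀ t y, R₁ + 1 ≤ ‖y‖ → Ψ.toFun t y = y := fun t y hy ↦ by
    change chartTransport Φ (G.toFun t) y = y
    refine chartTransport_eq_self (hRG t) fun hmem ↦ ?_
    have := mem_closedBall_zero_iff.1 (hR₁ hmem)
    linarith
  -- Step 4: the affine isotopy from `z ↦ q + 2 z` to `η L`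
  obtain ⟨T, hT⟩ := exists_equiv_coe_eq_smul (s := (2 : ℝ)) two_ne_zero
    (ContinuousLinearEquiv.refl ℝ (𝔼 3))
  obtain ⟨M, hM⟩ := exists_equiv_coe_eq_smul (s := η) hη.ne' L
  have hTapp : ∀ z, T z = (2 : ℝ) • z := fun z ↦ by
    have := congrArg (fun A : 𝔼 3 →L[ℝ] 𝔼 3 ↦ A z) hT
    simpa using this
  have hMapp : ∀ z, M z = η • L z := fun z ↦ by
    have := congrArg (fun A : 𝔼 3 →L[ℝ] 𝔼 3 ↦ A z) hM
    simpa using this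
  have hdetTM : 0 < (toMat (T : 𝔼 3 →L[ℝ] 𝔼 3)).det * (toMat (M : 𝔼 3 →L[ℝ] 𝔼 3)).det := by
    rw [hT, hM, det_toMat_smul, det_toMat_smul, det_toMat_refl]; positivity
  obtain ⟨FA, hFA1, RA, hRA⟩ := exists_ambientIsotopy_affine q 0 0 T M hdetTM 1
  have hFA1' : ∀ z : 𝔼 3, ‖z‖ = 1 → FA.toFun 1 (q + (2 : ℝ) • z) = η • L z := fun z hz ↦ by
    have := hFA1 z (mem_closedBall_zero_iff.2 hz.le)
    simpa [hTapp, hMapp] using this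
  -- Step 5: the three set identities
  have e1 : Ψ.toFun 1 '' (Φ.symm '' sphere 0 a) = Φ.symm '' sphere 0 η := by
    rw [image_image]
    have : (fun z ↦ Ψ.toFun 1 (Φ.symm z)) '' sphere (0 : 𝔼 3) a =
        (fun z ↦ Φ.symm ((η / a) • z)) '' sphere (0 : 𝔼 3) a :=
      image_congr fun z hz ↦ by rw [hΨ, hG1' z (mem_sphere_zero_iff_norm.1 hz)]
    rw [this, ← image_image (g := (Φ.symm : 𝔼 3 → 𝔼 3)) (f := fun z : 𝔼 3 ↦ (η / a) • z),
      image_smul_sphere_zero (by positivity), div_mul_cancel₀ _ ha.ne']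
  have e2 : FL.toFun 1 '' (L '' sphere 0 η) = Φ.symm '' sphere 0 η := by
    rw [image_image]
    refine image_congr fun z hz ↦ ?_
    have hzρ : dist (L z) 0 < ρ := by
      rw [dist_zero_right]; exact hηL z (mem_sphere_zero_iff_norm.1 hz)
    rw [hFLρ hzρ, hP_def]
    simp
  have e3 : FA.toFun 1 '' sphere q 2 = L '' sphere 0 η := by
    rw [← image_add_two_smul_sphere q, image_image]
    have : (fun z ↦ FA.toFun 1 (q + (2 : ℝ) • z)) '' sphere (0 : 𝔼 3) 1 =
        (fun z ↦ L (η • z)) '' sphere (0 : 𝔼 3) 1 :=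
      image_congr fun z hz ↦ by rw [hFA1' z (mem_sphere_zero_iff_norm.1 hz), map_smul]
    rw [this, ← image_image (g := (L : 𝔼 3 → 𝔼 3)) (f := fun z : 𝔼 3 ↦ η • z),
      image_smul_sphere_zero hη, mul_one]
  -- Step 6: assemble
  refine ⟨(Ψ.comp FL.reverse).comp FA.reverse, ?_, max (max (R₁ + 1) RL) RA, fun t y hy ↦ ?_⟩
  · rw [AmbientIsotopy.comp_toFun, AmbientIsotopy.comp_toFun, image_comp, image_comp, e1, ← e2,
      AmbientIsotopy.reverse_one_image_image, ← e3, AmbientIsotopy.reverse_one_image_image]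
  · have hy₁ : R₁ + 1 ≤ ‖y‖ := le_trans (le_trans (le_max_left _ _) (le_max_left _ _)) hy
    have hy₂ : RL ≤ ‖y‖ := le_trans (le_trans (le_max_right _ _) (le_max_left _ _)) hy
    have hy₃ : RA ≤ ‖y‖ := le_trans (le_max_right _ _) hy
    rw [AmbientIsotopy.comp_toFun, comp_apply, AmbientIsotopy.comp_toFun, comp_apply,
      hΨsupp t y hy₁, AmbientIsotopy.reverse_eq_self_of_le hRL t y hy₂,
      AmbientIsotopy.reverse_eq_self_of_le hRA t y hy₃]

end Chart

/-! ### Removing the orientation hypothesis: reflect the source if necessary -/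

section Reflection

open AffineIsotopy

/-- A coordinate reflection of `ℝ³`: a linear involution preserving the norm, with determinant
`-1`. [folklore] -/
theorem exists_reflection_three :
    ∃ ρ : 𝔼 3 ≃L[ℝ] 𝔼 3, (toMat (ρ : 𝔼 3 →L[ℝ] 𝔼 3)).det = -1 ∧ (∀ z, ρ.symm z = ρ z) ∧
      (∀ z, ρ (ρ z) = z) ∧ ∀ z, ‖ρ z‖ = ‖z‖ := by
  set d : Fin 3 → ℝ := ![-1, 1, 1] with hd
  set D : Matrix (Fin 3) (Fin 3) ℝ := Matrix.diagonal d with hD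
  have hdd : ∀ i, d i * d i = 1 := fun i ↦ by fin_cases i <;> simp [hd]
  have hDD : D * D = 1 := by
    rw [hD, Matrix.diagonal_mul_diagonal, ← Matrix.diagonal_one]
    congr 1
    funext i
    exact hdd i
  have hinv : ∀ z, toCLM D (toCLM D z) = z := fun z ↦ by
    rw [← toCLM_mul_apply, hDD, toCLM_one_apply]
  have happ : ∀ (z : 𝔼 3) (i : Fin 3), toCLM D z i = d i * z i := fun z i ↦ by
    rw [toCLM_apply, hD]
    simp [Matrix.diagonal_apply]
  refine ⟨ContinuousLinearEquiv.equivOfInverse (toCLM D) (toCLM D) hinv hinv, ?_, fun z ↦ rfl,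
    hinv, fun z ↦ ?_⟩
  · change (toMat (toCLM D)).det = -1
    rw [toMat_toCLM, hD, Matrix.det_diagonal, Fin.prod_univ_three]
    simp [hd]
  · change ‖toCLM D z‖ = ‖z‖
    rw [EuclideanSpace.norm_eq, EuclideanSpace.norm_eq]
    congr 1
    refine Finset.sum_congr rfl fun i _ ↦ ?_
    rw [happ, norm_mul, mul_pow]
    have : ‖d i‖ ^ 2 = 1 := by fin_cases i <;> simp [hd]
    rw [this, one_mul]

/-- A norm-preserving involution maps every sphere about `0` onto itself. [folklore] -/
theorem image_sphere_of_involutive_of_norm_eq {E : Type*} [NormedAddCommGroup E] {ρ : E → E}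
    (hρρ : ∀ z, ρ (ρ z) = z) (hρn : ∀ z, ‖ρ z‖ = ‖z‖) (a : ℝ) :
    ρ '' sphere (0 : E) a = sphere 0 a := by
  ext w
  simp only [mem_image, mem_sphere_zero_iff_norm]
  exact ⟨fun ⟨z, hz, hzw⟩ ↦ by rw [← hzw, hρn, hz], fun hw ↦ ⟨ρ w, by rw [hρn, hw], hρρ w⟩⟩

/-- **The chart form of the disc argument without orientation hypothesis.** As
`exists_ambientIsotopy_image_sphere_of_chart`, for any invertible derivative `L` of `Φ⁻¹` at
`0`: if `det L < 0`, precompose `Φ⁻¹` with a reflection `ρ` of `ℝ³`, which does not change the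
image of the round sphere `S(0, a)` but changes the sign of the determinant (Hirsch (1976),
Ch. 8 §3, proof of Thm. 3.1: "both preserve, or both reverse, orientation" — for the *image*
of a disc the orientation of the parametrisation is immaterial).
[cite: HirschDT1976, Ch. 8 §3, Thm. 3.1 (proof)] -/
theorem exists_ambientIsotopy_image_sphere_of_chart'
    (Φ : OpenPartialHomeomorph (𝔼 3) (𝔼 3)) (hΦt : Φ.target = univ)
    (hΦ : ContMDiffOn 𝓘(ℝ, 𝔼 3) 𝓘(ℝ, 𝔼 3) ∞ Φ Φ.source)
    (hΦ' : ContMDiff 𝓘(ℝ, 𝔼 3) 𝓘(ℝ, 𝔼 3) ∞ Φ.symm)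
    (h0 : Φ.symm 0 = 0) {L : 𝔼 3 ≃L[ℝ] 𝔼 3}
    (hL : HasFDerivAt Φ.symm (L : 𝔼 3 →L[ℝ] 𝔼 3) 0) {a : ℝ} (ha : 0 < a) (q : 𝔼 3) :
    ∃ H : AmbientIsotopy 𝓘(ℝ, 𝔼 3) (𝔼 3),
      H.toFun 1 '' (Φ.symm '' sphere 0 a) = sphere q 2 ∧
      ∃ R : ℝ, ∀ t y, R ≤ ‖y‖ → H.toFun t y = y := by
  rcases lt_or_gt_of_ne (det_toMat_ne_zero L) with hneg | hpos
  · obtain ⟨ρ, hρdet, hρsymm, hρρ, hρn⟩ := exists_reflection_three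
    set Φ₁ := Φ.transHomeomorph ρ.toHomeomorph with hΦ₁
    have hcoe : ∀ x, Φ₁ x = ρ (Φ x) := fun x ↦ rfl
    have hcoe' : ∀ y, Φ₁.symm y = Φ.symm (ρ y) := fun y ↦ by
      rw [hΦ₁, OpenPartialHomeomorph.transHomeomorph_symm_apply, comp_apply]
      exact congrArg Φ.symm (hρsymm y)
    have h1t : Φ₁.target = univ := by
      rw [hΦ₁, OpenPartialHomeomorph.transHomeomorph_target, hΦt, preimage_univ]
    have h1s : Φ₁.source = Φ.source := by
      rw [hΦ₁, OpenPartialHomeomorph.transHomeomorph_source]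
    have hρsm : ContMDiff 𝓘(ℝ, 𝔼 3) 𝓘(ℝ, 𝔼 3) ∞ (ρ : 𝔼 3 → 𝔼 3) :=
      contMDiff_iff_contDiff.2 (ρ : 𝔼 3 →L[ℝ] 𝔼 3).contDiff
    have h1 : ContMDiffOn 𝓘(ℝ, 𝔼 3) 𝓘(ℝ, 𝔼 3) ∞ Φ₁ Φ₁.source := by
      rw [h1s]
      exact hρsm.comp_contMDiffOn hΦ
    have h1' : ContMDiff 𝓘(ℝ, 𝔼 3) 𝓘(ℝ, 𝔼 3) ∞ Φ₁.symm := by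
      have : (Φ₁.symm : 𝔼 3 → 𝔼 3) = Φ.symm ∘ ρ := funext fun y ↦ hcoe' y
      rw [this]
      exact hΦ'.comp hρsm
    have h10 : Φ₁.symm 0 = 0 := by rw [hcoe', map_zero, h0]
    have hL1 : HasFDerivAt Φ₁.symm ((ρ.trans L : 𝔼 3 ≃L[ℝ] 𝔼 3) : 𝔼 3 →L[ℝ] 𝔼 3) 0 := by
      have : (Φ₁.symm : 𝔼 3 → 𝔼 3) = Φ.symm ∘ ρ := funext fun y ↦ hcoe' y
      rw [this]
      have h1 : HasFDerivAt Φ.symm (L : 𝔼 3 →L[ℝ] 𝔼 3) (ρ 0) := by rw [map_zero]; exact hL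
      exact h1.comp (0 : 𝔼 3) (ρ : 𝔼 3 →L[ℝ] 𝔼 3).hasFDerivAt
    have hdet1 : 0 < (toMat ((ρ.trans L : 𝔼 3 ≃L[ℝ] 𝔼 3) : 𝔼 3 →L[ℝ] 𝔼 3)).det := by
      rw [← ContinuousLinearEquiv.comp_coe, toMat_comp, Matrix.det_mul, hρdet]
      linarith
    obtain ⟨H, hH, hR⟩ :=
      exists_ambientIsotopy_image_sphere_of_chart Φ₁ h1t h1 h1' h10 hL1 hdet1 ha q
    refine ⟨H, ?_, hR⟩
    have himg : Φ₁.symm '' sphere 0 a = Φ.symm '' sphere 0 a := by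
      have : (Φ₁.symm : 𝔼 3 → 𝔼 3) = Φ.symm ∘ ρ := funext fun y ↦ hcoe' y
      rw [this, image_comp, image_sphere_of_involutive_of_norm_eq hρρ hρn]
    rwa [himg] at hH
  · exact exists_ambientIsotopy_image_sphere_of_chart Φ hΦt hΦ hΦ' h0 hL hpos ha q

end Reflection

end Literature.Topology.FourManifolds
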